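/-
COR-CM (cell pub-hodgecm2, stage 2 of the Hodge ladder) — count-neutral KERNEL COMBINATORICS «census ↔ tree dictionary, part 3:
orbit cells» (seat prover-pub-hodgecm2-b23-g32-0, binder prover b23, gen 32; claim INT2-TRANSPORT, HOME/lit/LIT-STATUS.md
2026-08-21T15:20:31Z, addendum 15:42Z; sequel of `CorCM/FaceCensusDictionary.lean`).  Pure combinatorics; theorems only; no
geometry, no `Universe`, no definition, no named fact, nothing asserted.  Seat b30's census engine (`Census/FaceSquaresModel.lean`)
is used BY NAME; nothing of theirs is restated or re-filed; `Interfaces.lean` (C1), every E term, B01 and `Transposition/*` are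
untouched.  HONEST FRAMING (COORDINATOR RULING — HODGE FRAMING CORRECTION, 2026-08-21T11:55:35Z): `HC_CM` is NOT proved, here or
anywhere in the tree; this file proves no face period and no generation statement for any particular field.
T5 (coordinator ruling 15:33:56Z (3), lead staging l.4095): n/a-class — NO named-fact / conjecture-def / summit-side supply binder in any
theorem; the ordinary hypotheses (a Cayley table `Γ`, an enumeration `e : GalT F ≃ Fin n` with `e (P*Q) = Γ.mul (e P) (e Q)`,
`e conjT = Γ.conj`, codes `T < 2^n ∧ ∀ i, mem i T = true ↔ e⁻¹ i ∈ Ψ`) are JOINTLY INHABITED for every Galois CM field by transport of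
structure (any bijection `e`, `Γ.mul i j := e (e⁻¹ i * e⁻¹ j)`, `Γ.conj := e conjT`; codes by `FaceCensus.exists_code`) — no
contradiction derivable; checker: self (prover-pub-hodgecm2-b23-g32-0), 2026-08-21T16:20Z.
-/
import Summits.HodgeConjecture.CorCM.FaceCensusDictionary
import HarnessLib

/-!
# Orbit cells read through the census ↔ tree dictionary

In seat b30's generation certificates (`Census/FaceSquaresLattice.lean`, `certOK`) every generator face lies in the ORBIT of a
representative `r`: its type square is a Galois twist `·g_j` of the square of `r`.  Concretely (and this is what the per-type files
re-certify by `decide`, `CorCM/FaceCensusTransport.lean` hypothesis `horb`) it is one of the EIGHT faces of the orbit cell of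
`(r, j)`: the four square mates `Φ, Φ^{(π)}, Φ^{(π′)}, Φ^{(ππ′)}` over the twisted places `(π, π′)`, in both orders.  This file shows
that each of the eight has a corner indicator in `span ℤ {weightRel g.corner (fun _ ↦ {σ}) | g ∈ 𝒮, σ} ⊔ pairRel` as soon as `𝒮`
contains a tree face `R` of code `r`, and that this indicator evaluates through the dictionary to b30's `1_{Γ.corners}`:

* §1 (tree level, no codes) place swaps and the opposite corner permute the four corners; the square mates along one place have
  corner indicator `= −` that of the face `+` the four pairs of the square (`weightRel_corner_swap`,
  `weightRel_corner_flip_add_mem_pairRel`, `weightRel_corner_flipflip`);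
* §2 the twist by `g_j` is realised by READING `R` AT THE BASE EMBEDDING `(e⁻¹ j)⁻¹ σ₀` (`code_pullType_baseChange`,
  `placeMask_translate_baseChange` of the dictionary), whence `exists_repr_of_mem_cell`.

References: [QW8] Def. 2.3 and rfwf v3 §8 (the cell's 2001 sources; kernel `CM/LefschetzChar*`, `Prior/AllgGroup*`);
[cite: Pohlmann1968, Thm. 1]; [cite: Milne1999LefschetzClasses, Thm. 3.2].
-/

noncomputable section

open NumberField NumberField.ComplexEmbedding
open scoped symmDiff

namespace Summit.HodgeConjecture.CorCM.FaceCensus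

open Literature.AlgebraicGeometry.Motives (CMType)
open Literature.NumberTheory.ComplexMultiplication.CMTypeOps
open Summit.HodgeConjecture.CorCM.Prior.AllgGroup.RfwfAllgGroup
open Summit.HodgeConjecture.CorCM.Census.FaceSquaresModel

variable {F : Type} [Field F] [NumberField F]
/-! ## §1 Square mates and place swaps: corner indicators up to sign and pairs -/

/-- Flipping twice at the same place is the identity on abstract CM types. [folklore] -/
theorem oflipCM_oflipCM_self (t : GalT F) (Ψ : CMF (GalT F) conjT) :
    oflipCM conjT conjT_mul_self t (oflipCM conjT conjT_mul_self t Ψ) = Ψ := by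
  apply Subtype.ext
  change (Ψ.1 ∆ orb conjT t) ∆ orb conjT t = Ψ.1
  rw [symmDiff_assoc, symmDiff_self, symmDiff_bot]

variable [IsGalois ℚ F]

/-- **Place swap**: exchanging `π, π′` permutes the corners, so the corner indicator is unchanged. [folklore] -/
theorem weightRel_corner_swap (Φ : CMType F) (p p' : F →+* ℂ) (h : InfinitePlace.mk p ≠ InfinitePlace.mk p') (σ : F →+* ℂ) :
    weightRel (⟨Φ, p', p, h.symm⟩ : Face F).corner (fun _ => ({σ} : Finset (F →+* ℂ))) =
      weightRel (⟨Φ, p, p', h⟩ : Face F).corner (fun _ => ({σ} : Finset (F →+* ℂ))) := by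
  rw [weightRel_corner_eq_read, weightRel_corner_eq_read]
  change Finsupp.single (pullType Φ σ) 1 +
      Finsupp.single (barCM (oflipCM conjT conjT_mul_self (translate σ p') (pullType Φ σ))) 1 +
      Finsupp.single (barCM (oflipCM conjT conjT_mul_self (translate σ p) (pullType Φ σ))) 1 +
      Finsupp.single (oflipCM conjT conjT_mul_self (translate σ p)
        (oflipCM conjT conjT_mul_self (translate σ p') (pullType Φ σ))) 1 =
    Finsupp.single (pullType Φ σ) 1 +
      Finsupp.single (barCM (oflipCM conjT conjT_mul_self (translate σ p) (pullType Φ σ))) 1 +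
      Finsupp.single (barCM (oflipCM conjT conjT_mul_self (translate σ p') (pullType Φ σ))) 1 +
      Finsupp.single (oflipCM conjT conjT_mul_self (translate σ p')
        (oflipCM conjT conjT_mul_self (translate σ p) (pullType Φ σ))) 1
  rw [oflipCM_comm (translate σ p) (translate σ p')]
  abel

/-- **Square mate along `π`**: the corner indicators of `(Φ^{(π)}; π, π′)` and `(Φ; π, π′)` add up to the four pairs of the
square, so they agree up to sign modulo `pairRel`. [folklore] -/
theorem weightRel_corner_flip_add_mem_pairRel (Φ : CMType F) (p p' : F →+* ℂ) (h : InfinitePlace.mk p ≠ InfinitePlace.mk p')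
    (σ : F →+* ℂ) :
    weightRel (⟨flip p Φ, p, p', h⟩ : Face F).corner (fun _ => ({σ} : Finset (F →+* ℂ))) +
      weightRel (⟨Φ, p, p', h⟩ : Face F).corner (fun _ => ({σ} : Finset (F →+* ℂ))) ∈ pairRel := by
  rw [weightRel_corner_eq_read, weightRel_corner_eq_read]
  change Finsupp.single (pullType (flip p Φ) σ) 1 +
      Finsupp.single (barCM (oflipCM conjT conjT_mul_self (translate σ p) (pullType (flip p Φ) σ))) 1 +
      Finsupp.single (barCM (oflipCM conjT conjT_mul_self (translate σ p') (pullType (flip p Φ) σ))) 1 +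
      Finsupp.single (oflipCM conjT conjT_mul_self (translate σ p')
        (oflipCM conjT conjT_mul_self (translate σ p) (pullType (flip p Φ) σ))) 1 +
    (Finsupp.single (pullType Φ σ) 1 +
      Finsupp.single (barCM (oflipCM conjT conjT_mul_self (translate σ p) (pullType Φ σ))) 1 +
      Finsupp.single (barCM (oflipCM conjT conjT_mul_self (translate σ p') (pullType Φ σ))) 1 +
      Finsupp.single (oflipCM conjT conjT_mul_self (translate σ p')
        (oflipCM conjT conjT_mul_self (translate σ p) (pullType Φ σ))) 1) ∈ pairRel
  rw [pullType_flip_translate, oflipCM_oflipCM_self]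
  have e : Finsupp.single (oflipCM conjT conjT_mul_self (translate σ p) (pullType Φ σ)) (1 : ℤ) +
      Finsupp.single (barCM (pullType Φ σ)) 1 +
      Finsupp.single (barCM (oflipCM conjT conjT_mul_self (translate σ p')
        (oflipCM conjT conjT_mul_self (translate σ p) (pullType Φ σ)))) 1 +
      Finsupp.single (oflipCM conjT conjT_mul_self (translate σ p') (pullType Φ σ)) 1 +
    (Finsupp.single (pullType Φ σ) 1 +
      Finsupp.single (barCM (oflipCM conjT conjT_mul_self (translate σ p) (pullType Φ σ))) 1 +
      Finsupp.single (barCM (oflipCM conjT conjT_mul_self (translate σ p') (pullType Φ σ))) 1 +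
      Finsupp.single (oflipCM conjT conjT_mul_self (translate σ p')
        (oflipCM conjT conjT_mul_self (translate σ p) (pullType Φ σ))) 1) =
    (Finsupp.single (pullType Φ σ) 1 + Finsupp.single (barCM (pullType Φ σ)) 1) +
    (Finsupp.single (oflipCM conjT conjT_mul_self (translate σ p) (pullType Φ σ)) 1 +
      Finsupp.single (barCM (oflipCM conjT conjT_mul_self (translate σ p) (pullType Φ σ))) 1) +
    (Finsupp.single (oflipCM conjT conjT_mul_self (translate σ p') (pullType Φ σ)) 1 +
      Finsupp.single (barCM (oflipCM conjT conjT_mul_self (translate σ p') (pullType Φ σ))) 1) +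
    (Finsupp.single (oflipCM conjT conjT_mul_self (translate σ p')
        (oflipCM conjT conjT_mul_self (translate σ p) (pullType Φ σ))) 1 +
      Finsupp.single (barCM (oflipCM conjT conjT_mul_self (translate σ p')
        (oflipCM conjT conjT_mul_self (translate σ p) (pullType Φ σ)))) 1) := by
    abel
  rw [e]
  refine Submodule.add_mem _ (Submodule.add_mem _ (Submodule.add_mem _ ?_ ?_) ?_) ?_ <;>
    exact Submodule.subset_span ⟨_, rfl⟩

/-- **Opposite corner of the square**: `(Φ^{(ππ′)}; π, π′)` has the same corners as `(Φ; π, π′)` (permuted). [folklore] -/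
theorem weightRel_corner_flipflip (Φ : CMType F) (p p' : F →+* ℂ) (h : InfinitePlace.mk p ≠ InfinitePlace.mk p') (σ : F →+* ℂ) :
    weightRel (⟨flip p' (flip p Φ), p, p', h⟩ : Face F).corner (fun _ => ({σ} : Finset (F →+* ℂ))) =
      weightRel (⟨Φ, p, p', h⟩ : Face F).corner (fun _ => ({σ} : Finset (F →+* ℂ))) := by
  rw [weightRel_corner_eq_read, weightRel_corner_eq_read]
  change Finsupp.single (pullType (flip p' (flip p Φ)) σ) 1 +
      Finsupp.single (barCM (oflipCM conjT conjT_mul_self (translate σ p) (pullType (flip p' (flip p Φ)) σ))) 1 +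
      Finsupp.single (barCM (oflipCM conjT conjT_mul_self (translate σ p') (pullType (flip p' (flip p Φ)) σ))) 1 +
      Finsupp.single (oflipCM conjT conjT_mul_self (translate σ p')
        (oflipCM conjT conjT_mul_self (translate σ p) (pullType (flip p' (flip p Φ)) σ))) 1 =
    Finsupp.single (pullType Φ σ) 1 +
      Finsupp.single (barCM (oflipCM conjT conjT_mul_self (translate σ p) (pullType Φ σ))) 1 +
      Finsupp.single (barCM (oflipCM conjT conjT_mul_self (translate σ p') (pullType Φ σ))) 1 +
      Finsupp.single (oflipCM conjT conjT_mul_self (translate σ p')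
        (oflipCM conjT conjT_mul_self (translate σ p) (pullType Φ σ))) 1
  rw [pullType_flip_translate, pullType_flip_translate,
    oflipCM_comm (translate σ p) (translate σ p') (oflipCM conjT conjT_mul_self (translate σ p) (pullType Φ σ)),
    oflipCM_oflipCM_self, oflipCM_oflipCM_self, oflipCM_oflipCM_self]
  abel

/-! ## §2 The eight faces of an orbit cell, read through the dictionary -/

variable {n : ℕ} (Γ : CMGaloisType n) (e : GalT F ≃ Fin n)

/-- **Every face of an orbit cell of a representative `R ∈ 𝒮` has a corner indicator in `span ⊔ pairRel` that evaluates,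
through the dictionary, to b30's `1_{corners}`.**  The cell of `r` twisted by `g_j` consists of the four square mates over the
twisted places in both orders; the twist is realised by reading `R` at the base embedding `(e⁻¹ j)⁻¹ σ₀`. [folklore] -/
theorem exists_repr_of_mem_cell (hmul : ∀ P Q : GalT F, e (P * Q) = Γ.mul (e P) (e Q)) (hconj : e conjT = Γ.conj)
    (σ₀ : F →+* ℂ) (𝒮 : Set (Face F)) {R : Face F} (hR : R ∈ 𝒮) {r : ℕ × ℕ × ℕ}
    (hr : (r.1 < 2 ^ n ∧ ∀ i : Fin n, mem i r.1 = true ↔ e.symm i ∈ (pullType R.Φ σ₀).1) ∧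
      Γ.placeMask (e (translate σ₀ R.p)) = r.2.1 ∧ Γ.placeMask (e (translate σ₀ R.p')) = r.2.2)
    (j : Fin n) {φ : ℕ × ℕ × ℕ}
    (hφ : φ ∈ [(Γ.twist j r.1, Γ.twist j r.2.1, Γ.twist j r.2.2),
      (flipAt (Γ.twist j r.2.1) (Γ.twist j r.1), Γ.twist j r.2.1, Γ.twist j r.2.2),
      (flipAt (Γ.twist j r.2.2) (Γ.twist j r.1), Γ.twist j r.2.1, Γ.twist j r.2.2),
      (flipAt (Γ.twist j r.2.2) (flipAt (Γ.twist j r.2.1) (Γ.twist j r.1)), Γ.twist j r.2.1, Γ.twist j r.2.2),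
      (Γ.twist j r.1, Γ.twist j r.2.2, Γ.twist j r.2.1),
      (flipAt (Γ.twist j r.2.1) (Γ.twist j r.1), Γ.twist j r.2.2, Γ.twist j r.2.1),
      (flipAt (Γ.twist j r.2.2) (Γ.twist j r.1), Γ.twist j r.2.2, Γ.twist j r.2.1),
      (flipAt (Γ.twist j r.2.2) (flipAt (Γ.twist j r.2.1) (Γ.twist j r.1)), Γ.twist j r.2.2, Γ.twist j r.2.1)]) :
    ∃ X ∈ Submodule.span ℤ {y : CMF (GalT F) conjT →₀ ℤ | ∃ g ∈ 𝒮, ∃ σ : F →+* ℂ,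
        y = weightRel g.corner (fun _ => ({σ} : Finset (F →+* ℂ)))} ⊔ pairRel,
      ∀ (Ψ : CMF (GalT F) conjT) (S : ℕ), (S < 2 ^ n ∧ ∀ i : Fin n, mem i S = true ↔ e.symm i ∈ Ψ.1) →
        X Ψ = if (Γ.corners φ).contains S then 1 else 0 := by
  -- the base embedding realising the twist by `g_j`
  set Q : GalT F := (e.symm j)⁻¹ with hQ
  set σ : F →+* ℂ := Q.1 σ₀ with hσ
  have hj : e Q⁻¹ = j := by rw [hQ, inv_inv, e.apply_symm_apply]
  -- codes of `R` read at `σ`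
  have hT : Γ.twist j r.1 < 2 ^ n ∧ ∀ i : Fin n, mem i (Γ.twist j r.1) = true ↔ e.symm i ∈ (pullType R.Φ σ).1 := by
    rw [← hj]; exact code_pullType_baseChange Γ e hmul R.Φ σ₀ Q hr.1
  have hp : Γ.placeMask (e (translate σ R.p)) = Γ.twist j r.2.1 := by
    rw [hσ, placeMask_translate_baseChange Γ e hmul, hj, hr.2.1]
  have hq : Γ.placeMask (e (translate σ R.p')) = Γ.twist j r.2.2 := by
    rw [hσ, placeMask_translate_baseChange Γ e hmul, hj, hr.2.2]
  have hT1 : flipAt (Γ.twist j r.2.1) (Γ.twist j r.1) < 2 ^ n ∧ ∀ i : Fin n,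
      mem i (flipAt (Γ.twist j r.2.1) (Γ.twist j r.1)) = true ↔ e.symm i ∈ (pullType (flip R.p R.Φ) σ).1 := by
    rw [pullType_flip_translate, ← hp]; exact code_oflip Γ e hmul hconj hT _
  have hT2 : flipAt (Γ.twist j r.2.2) (Γ.twist j r.1) < 2 ^ n ∧ ∀ i : Fin n,
      mem i (flipAt (Γ.twist j r.2.2) (Γ.twist j r.1)) = true ↔ e.symm i ∈ (pullType (flip R.p' R.Φ) σ).1 := by
    rw [pullType_flip_translate, ← hq]; exact code_oflip Γ e hmul hconj hT _
  have hT3 : flipAt (Γ.twist j r.2.2) (flipAt (Γ.twist j r.2.1) (Γ.twist j r.1)) < 2 ^ n ∧ ∀ i : Fin n,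
      mem i (flipAt (Γ.twist j r.2.2) (flipAt (Γ.twist j r.2.1) (Γ.twist j r.1))) = true ↔
        e.symm i ∈ (pullType (flip R.p' (flip R.p R.Φ)) σ).1 := by
    rw [pullType_flip_translate, pullType_flip_translate, ← hp, ← hq]
    exact code_oflip Γ e hmul hconj (code_oflip Γ e hmul hconj hT _) _
  -- the corner indicator of `R` at `σ` generates
  have hRmem : weightRel R.corner (fun _ => ({σ} : Finset (F →+* ℂ))) ∈
      Submodule.span ℤ {y : CMF (GalT F) conjT →₀ ℤ | ∃ g ∈ 𝒮, ∃ σ : F →+* ℂ,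
        y = weightRel g.corner (fun _ => ({σ} : Finset (F →+* ℂ)))} ⊔ pairRel :=
    Submodule.mem_sup_left (Submodule.subset_span ⟨R, hR, σ, rfl⟩)
  have hReq : R = ⟨R.Φ, R.p, R.p', R.place_ne⟩ := rfl
  -- square mates: membership
  have hflip : ∀ (p p' : F →+* ℂ) (h : InfinitePlace.mk p ≠ InfinitePlace.mk p'),
      weightRel (⟨R.Φ, p, p', h⟩ : Face F).corner (fun _ => ({σ} : Finset (F →+* ℂ))) ∈
        Submodule.span ℤ {y : CMF (GalT F) conjT →₀ ℤ | ∃ g ∈ 𝒮, ∃ σ : F →+* ℂ,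
          y = weightRel g.corner (fun _ => ({σ} : Finset (F →+* ℂ)))} ⊔ pairRel →
      weightRel (⟨flip p R.Φ, p, p', h⟩ : Face F).corner (fun _ => ({σ} : Finset (F →+* ℂ))) ∈
        Submodule.span ℤ {y : CMF (GalT F) conjT →₀ ℤ | ∃ g ∈ 𝒮, ∃ σ : F →+* ℂ,
          y = weightRel g.corner (fun _ => ({σ} : Finset (F →+* ℂ)))} ⊔ pairRel := by
    intro p p' h hm
    have hs := weightRel_corner_flip_add_mem_pairRel R.Φ p p' h σ
    have e1 : weightRel (⟨flip p R.Φ, p, p', h⟩ : Face F).corner (fun _ => ({σ} : Finset (F →+* ℂ))) =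
        (weightRel (⟨flip p R.Φ, p, p', h⟩ : Face F).corner (fun _ => ({σ} : Finset (F →+* ℂ))) +
          weightRel (⟨R.Φ, p, p', h⟩ : Face F).corner (fun _ => ({σ} : Finset (F →+* ℂ)))) -
        weightRel (⟨R.Φ, p, p', h⟩ : Face F).corner (fun _ => ({σ} : Finset (F →+* ℂ))) := by abel
    rw [e1]
    exact Submodule.sub_mem _ (Submodule.mem_sup_right hs) hm
  have hm0 : weightRel (⟨R.Φ, R.p, R.p', R.place_ne⟩ : Face F).corner (fun _ => ({σ} : Finset (F →+* ℂ))) ∈ _ := hRmem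
  have hm4 : weightRel (⟨R.Φ, R.p', R.p, R.place_ne.symm⟩ : Face F).corner (fun _ => ({σ} : Finset (F →+* ℂ))) ∈
      Submodule.span ℤ {y : CMF (GalT F) conjT →₀ ℤ | ∃ g ∈ 𝒮, ∃ σ : F →+* ℂ,
        y = weightRel g.corner (fun _ => ({σ} : Finset (F →+* ℂ)))} ⊔ pairRel := by
    rw [weightRel_corner_swap]; exact hm0
  have hm1 := hflip R.p R.p' R.place_ne hm0
  have hm5 := hflip R.p' R.p R.place_ne.symm hm4
  have hm2 : weightRel (⟨flip R.p' R.Φ, R.p, R.p', R.place_ne⟩ : Face F).corner (fun _ => ({σ} : Finset (F →+* ℂ))) ∈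
      Submodule.span ℤ {y : CMF (GalT F) conjT →₀ ℤ | ∃ g ∈ 𝒮, ∃ σ : F →+* ℂ,
        y = weightRel g.corner (fun _ => ({σ} : Finset (F →+* ℂ)))} ⊔ pairRel := by
    rw [← weightRel_corner_swap]; exact hm5
  have hm6 : weightRel (⟨flip R.p R.Φ, R.p', R.p, R.place_ne.symm⟩ : Face F).corner (fun _ => ({σ} : Finset (F →+* ℂ))) ∈
      Submodule.span ℤ {y : CMF (GalT F) conjT →₀ ℤ | ∃ g ∈ 𝒮, ∃ σ : F →+* ℂ,
        y = weightRel g.corner (fun _ => ({σ} : Finset (F →+* ℂ)))} ⊔ pairRel := by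
    rw [weightRel_corner_swap]; exact hm1
  have hm3 : weightRel (⟨flip R.p' (flip R.p R.Φ), R.p, R.p', R.place_ne⟩ : Face F).corner
      (fun _ => ({σ} : Finset (F →+* ℂ))) ∈
      Submodule.span ℤ {y : CMF (GalT F) conjT →₀ ℤ | ∃ g ∈ 𝒮, ∃ σ : F →+* ℂ,
        y = weightRel g.corner (fun _ => ({σ} : Finset (F →+* ℂ)))} ⊔ pairRel := by
    rw [weightRel_corner_flipflip]; exact hm0
  have hm7 : weightRel (⟨flip R.p' (flip R.p R.Φ), R.p', R.p, R.place_ne.symm⟩ : Face F).corner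
      (fun _ => ({σ} : Finset (F →+* ℂ))) ∈
      Submodule.span ℤ {y : CMF (GalT F) conjT →₀ ℤ | ∃ g ∈ 𝒮, ∃ σ : F →+* ℂ,
        y = weightRel g.corner (fun _ => ({σ} : Finset (F →+* ℂ)))} ⊔ pairRel := by
    rw [weightRel_corner_swap]; exact hm3
  -- case split over the cell
  simp only [List.mem_cons, List.not_mem_nil, or_false] at hφ
  rcases hφ with rfl | rfl | rfl | rfl | rfl | rfl | rfl | rfl
  · refine ⟨_, hm0, fun Ψ S hS => ?_⟩
    rw [weightRel_corner_apply Γ e hmul hconj (⟨R.Φ, R.p, R.p', R.place_ne⟩ : Face F) σ hT Ψ hS]; rw [hp, hq]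
  · refine ⟨_, hm1, fun Ψ S hS => ?_⟩
    rw [weightRel_corner_apply Γ e hmul hconj (⟨flip R.p R.Φ, R.p, R.p', R.place_ne⟩ : Face F) σ hT1 Ψ hS]; rw [hp, hq]
  · refine ⟨_, hm2, fun Ψ S hS => ?_⟩
    rw [weightRel_corner_apply Γ e hmul hconj (⟨flip R.p' R.Φ, R.p, R.p', R.place_ne⟩ : Face F) σ hT2 Ψ hS]; rw [hp, hq]
  · refine ⟨_, hm3, fun Ψ S hS => ?_⟩
    rw [weightRel_corner_apply Γ e hmul hconj (⟨flip R.p' (flip R.p R.Φ), R.p, R.p', R.place_ne⟩ : Face F) σ hT3 Ψ hS]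
    rw [hp, hq]
  · refine ⟨_, hm4, fun Ψ S hS => ?_⟩
    rw [weightRel_corner_apply Γ e hmul hconj (⟨R.Φ, R.p', R.p, R.place_ne.symm⟩ : Face F) σ hT Ψ hS]; rw [hp, hq]
  · refine ⟨_, hm6, fun Ψ S hS => ?_⟩
    rw [weightRel_corner_apply Γ e hmul hconj (⟨flip R.p R.Φ, R.p', R.p, R.place_ne.symm⟩ : Face F) σ hT1 Ψ hS]
    rw [hp, hq]
  · refine ⟨_, hm5, fun Ψ S hS => ?_⟩
    rw [weightRel_corner_apply Γ e hmul hconj (⟨flip R.p' R.Φ, R.p', R.p, R.place_ne.symm⟩ : Face F) σ hT2 Ψ hS]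
    rw [hp, hq]
  · refine ⟨_, hm7, fun Ψ S hS => ?_⟩
    rw [weightRel_corner_apply Γ e hmul hconj (⟨flip R.p' (flip R.p R.Φ), R.p', R.p, R.place_ne.symm⟩ : Face F) σ hT3 Ψ hS]
    rw [hp, hq]

/-! ## §3 Enumerations from automorphisms (the dictionary datum a field-specific seat actually has) -/

omit Γ e in
/-- Complex conjugation is the translate carrying `σ₀` to `σ̄₀`. [folklore] -/
theorem conjT_eq_translate (σ₀ : F →+* ℂ) : (conjT : GalT F) = translate σ₀ (conjugate σ₀) :=
  GalT.ext_of_apply σ₀ (by rw [conjT_apply, translate_apply_self])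

omit Γ e in
/-- Translates compose like the automorphisms they come from: `T_{σ₀∘(gh)} = T_{σ₀∘g} T_{σ₀∘h}`. [folklore] -/
theorem translate_comp_mul (σ₀ : F →+* ℂ) (g h : F ≃ₐ[ℚ] F) :
    translate σ₀ (σ₀.comp ((g * h : F ≃ₐ[ℚ] F) : F →+* F)) =
      translate σ₀ (σ₀.comp (g : F →+* F)) * translate σ₀ (σ₀.comp (h : F →+* F)) := by
  refine GalT.ext_of_apply σ₀ ?_
  rw [translate_apply_self, GalT.mul_apply, translate_apply_self, GalT.apply_comp, translate_apply_self]
  ext x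
  simp [AlgEquiv.mul_apply]

omit e in
/-- **An enumeration of `Aut(F)` against the Cayley table induces the dictionary datum on `GalT F`.**  Given a base embedding `σ₀`
and a bijection `ε : Aut(F) ≃ Fin n` multiplicative for `Γ` (e.g. `ε⁻¹ i = gⁱ` for a generator `g` of a cyclic Galois group, or the
inverse of a census file's `enum` composed with an isomorphism to its Mathlib group), there is an enumeration `e : GalT F ≃ Fin n`,
multiplicative for `Γ`, reading `ε` on translates: `e (translate σ₀ (σ₀ ∘ g)) = ε g`.  With `conjT_eq_translate`, `e conjT = ε c` for
the automorphism `c` with `σ₀ ∘ c = σ̄₀`; and `P σ₀ ∈ Θ ↔ mem (e P) T` follows from `σ₀ ∘ g ∈ Θ ↔ mem (ε g) T` since every `P` is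
`translate σ₀ (σ₀ ∘ g)` (`exists_aut_eq`, `translate_apply_eq`). [folklore] -/
theorem exists_enum_of_autEnum (σ₀ : F →+* ℂ) (ε : (F ≃ₐ[ℚ] F) ≃ Fin n)
    (hε : ∀ g h : F ≃ₐ[ℚ] F, ε (g * h) = Γ.mul (ε g) (ε h)) :
    ∃ e : GalT F ≃ Fin n, (∀ P Q : GalT F, e (P * Q) = Γ.mul (e P) (e Q)) ∧
      ∀ g : F ≃ₐ[ℚ] F, e (translate σ₀ (σ₀.comp (g : F →+* F))) = ε g := by
  have hbij : Function.Bijective (fun g : F ≃ₐ[ℚ] F => translate σ₀ (σ₀.comp (g : F →+* F))) := by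
    constructor
    · intro g h hgh
      have h1 := congrArg (fun P : GalT F => P.1 σ₀) hgh
      simp only [translate_apply_self] at h1
      exact comp_aut_injective σ₀ h1
    · intro P
      obtain ⟨g, hg⟩ := exists_aut_eq σ₀ (P.1 σ₀)
      refine ⟨g, ?_⟩
      show translate σ₀ (σ₀.comp (g : F →+* F)) = P
      rw [← hg, translate_apply_eq]
  refine ⟨(Equiv.ofBijective _ hbij).symm.trans ε, fun P Q => ?_, fun g => ?_⟩
  · obtain ⟨g, rfl⟩ := hbij.2 P
    obtain ⟨h, rfl⟩ := hbij.2 Q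
    rw [← translate_comp_mul]
    simp only [Equiv.trans_apply]
    rw [show (Equiv.ofBijective _ hbij).symm (translate σ₀ (σ₀.comp ((g * h : F ≃ₐ[ℚ] F) : F →+* F))) = g * h from
        (Equiv.ofBijective _ hbij).symm_apply_eq.mpr rfl,
      show (Equiv.ofBijective _ hbij).symm (translate σ₀ (σ₀.comp (g : F →+* F))) = g from
        (Equiv.ofBijective _ hbij).symm_apply_eq.mpr rfl,
      show (Equiv.ofBijective _ hbij).symm (translate σ₀ (σ₀.comp (h : F →+* F))) = h from
        (Equiv.ofBijective _ hbij).symm_apply_eq.mpr rfl, hε]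
  · simp only [Equiv.trans_apply]
    rw [show (Equiv.ofBijective _ hbij).symm (translate σ₀ (σ₀.comp (g : F →+* F))) = g from
        (Equiv.ofBijective _ hbij).symm_apply_eq.mpr rfl]

/-- **Face readings from automorphism data.**  If `e` reads `ε` on translates (`exists_enum_of_autEnum`), a face `R` whose base
type is described through `ε` (`σ₀ ∘ g ∈ R.Φ ↔ mem (ε g) T`) and whose place representatives are `σ₀ ∘ g_p`, `σ₀ ∘ g_q` reads as
the code `(T, placeMask (ε g_p), placeMask (ε g_q))` in the sense of the transport hypotheses. [folklore] -/
theorem reads_of_autEnum (σ₀ : F →+* ℂ) (ε : (F ≃ₐ[ℚ] F) ≃ Fin n)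
    (he : ∀ g : F ≃ₐ[ℚ] F, e (translate σ₀ (σ₀.comp (g : F →+* F))) = ε g) (R : Face F) {T p q : ℕ}
    {gp gq : F ≃ₐ[ℚ] F} (hΦ : ∀ g : F ≃ₐ[ℚ] F, σ₀.comp (g : F →+* F) ∈ R.Φ.1 ↔ mem (ε g) T = true)
    (hp : R.p = σ₀.comp (gp : F →+* F)) (hp' : Γ.placeMask (ε gp) = p)
    (hq : R.p' = σ₀.comp (gq : F →+* F)) (hq' : Γ.placeMask (ε gq) = q) :
    (∀ P : GalT F, P.1 σ₀ ∈ R.Φ.1 ↔ mem (e P) T = true) ∧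
      Γ.placeMask (e (translate σ₀ R.p)) = p ∧ Γ.placeMask (e (translate σ₀ R.p')) = q := by
  refine ⟨fun P => ?_, by rw [hp, he, hp'], by rw [hq, he, hq']⟩
  obtain ⟨g, hg⟩ := exists_aut_eq σ₀ (P.1 σ₀)
  have hP : P = translate σ₀ (σ₀.comp (g : F →+* F)) := by rw [← hg, translate_apply_eq]
  rw [hg, hΦ, hP, he]

/-! ## §4 Non-vacuity: every face code of the model is read by a tree face -/

omit [IsGalois ℚ F] in
/-- Conjugate indices have the same place mask. [folklore] -/
theorem placeMask_conj (hmul : ∀ P Q : GalT F, e (P * Q) = Γ.mul (e P) (e Q)) (hconj : e conjT = Γ.conj) (i : Fin n) :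
    Γ.placeMask (Γ.mul Γ.conj i) = Γ.placeMask i := by
  apply eq_of_mem_iff (placeMask_lt Γ _) (placeMask_lt Γ _)
  intro k
  rw [mem_placeMask, mem_placeMask, conj_mul_conj_mul Γ e hmul hconj]
  exact or_comm

/-- **NON-VACUITY of the transport hypotheses.**  Under the dictionary every face code `r ∈ Γ.faces` of the model IS READ by some
tree face `R` of `F` at `σ₀` (`pullType R.Φ σ₀` has code `r.1`, the places of `R` have masks `r.2.1`, `r.2.2`): the sets `𝒮` the
transport asks for exist for every enumerated field. [folklore] -/
theorem exists_face_reads (hmul : ∀ P Q : GalT F, e (P * Q) = Γ.mul (e P) (e Q)) (hconj : e conjT = Γ.conj)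
    (σ₀ : F →+* ℂ) {r : ℕ × ℕ × ℕ} (hr : r ∈ Γ.faces) :
    ∃ R : Face F, (r.1 < 2 ^ n ∧ ∀ i : Fin n, mem i r.1 = true ↔ e.symm i ∈ (pullType R.Φ σ₀).1) ∧
      Γ.placeMask (e (translate σ₀ R.p)) = r.2.1 ∧ Γ.placeMask (e (translate σ₀ R.p')) = r.2.2 := by
  obtain ⟨T, p, q⟩ := r
  unfold CMGaloisType.faces at hr
  rw [List.mem_flatMap] at hr
  obtain ⟨T', hT', hr⟩ := hr
  rw [List.mem_flatMap] at hr
  obtain ⟨p', hp', hr⟩ := hr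
  rw [List.mem_map] at hr
  obtain ⟨q', hq', hr⟩ := hr
  simp only [Prod.mk.injEq] at hr
  obtain ⟨rfl, rfl, rfl⟩ := hr
  rw [List.mem_filter] at hq'
  obtain ⟨hq', hqp⟩ := hq'
  obtain ⟨Ψ, hΨ⟩ := exists_of_isCMType Γ e hmul hconj ((mem_cmTypes_iff Γ T').mp hT').2
  unfold CMGaloisType.places at hp' hq'
  rw [mem_normalize, List.mem_map] at hp' hq'
  obtain ⟨i, -, rfl⟩ := hp'
  obtain ⟨i', -, rfl⟩ := hq'
  have ht' : e.symm i' ∉ orb conjT (e.symm i) := by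
    rw [mem_orb]
    rintro (h | h)
    · exact (bne_iff_ne.mp hqp) (by rw [e.symm.injective h])
    · apply bne_iff_ne.mp hqp
      have hi' : i' = Γ.mul Γ.conj i := by rw [conj_mul_eq Γ e hmul hconj, ← h, e.apply_symm_apply]
      rw [hi', placeMask_conj Γ e hmul hconj]
  refine ⟨faceOfG σ₀ Ψ (e.symm i) (e.symm i') ht', ?_, ?_, ?_⟩
  · change T' < 2 ^ n ∧ ∀ j : Fin n, mem j T' = true ↔ e.symm j ∈ (pullType (pushType σ₀ Ψ) σ₀).1
    rw [pullType_pushType]; exact hΨ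
  · change Γ.placeMask (e (translate σ₀ ((e.symm i).1 σ₀))) = Γ.placeMask i
    rw [translate_apply_eq, e.apply_symm_apply]
  · change Γ.placeMask (e (translate σ₀ ((e.symm i').1 σ₀))) = Γ.placeMask i'
    rw [translate_apply_eq, e.apply_symm_apply]

end Summit.HodgeConjecture.CorCM.FaceCensus

end
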